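import Mathlib

/-!
# Definitions for the bubbling reduction (obligation (B) of line `wall_bubbling`, `DoorA26`) — turnkey helper, val-idea-15

Module of the BUBBLING REDUCTION for obligation (B) `Stmt.stub_bubbling` of the line `Cruxes/DoorA26/Lines/wall_bubbling.lean`
(stmt-ValiantsHypothesis-19979, `Theses.LacunarySymmetroid.DoorA26`).  Contents: STATEMENT-ONLY module: the definitions shared by the bubbling modules — real exponential sums `expSum`, class sums `classSum`,
the inertia predicates `IsSymGram` / `TwoPos` / `ThreeNeg`, the polar form `polar` of `det` on `2 × 2` matrices, realisable polar Gram
matrices `Realisable`, vanishing block sums `BlockSumsZero`, the twenty-locus `TwentyLocus`, the sorted simplex `SortedSimplex`, the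
obligation `Stmt.stub_bubbling` (VERBATIM copies of the line file `Cruxes/DoorA26/Lines/wall_bubbling.lean`, so the line's stub (B)
closes by definitional unfolding from `stub_bubbling_proof` in `…BubblingAssembly`), members `Pair` / `pairExp` and the cluster-limit
record `ClusterLimit`. [this work]

HONEST FRAMING / PROVENANCE.  Turnkey port of ideator val-idea-15 g1 (crux workfile `Cruxes/DoorA26/Lines/wall_bubbling_Assembly.lean`, commit d4cb61350496, ZERO `sorry`; split into ≤ 400-line modules, one
namespace `…WallBubbling.Bubbling`, single copies of the definitions), filed by prover seat val-port-4 g1 (val-lit port pool; desk g12 RULING #266 (b), director R166/R168) with `--supports stmt-ValiantsHypothesis-19979 --as helper`.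
Mathlib-only mathematics (elementary real analysis, linear algebra, finite combinatorics); nothing here bears on `DoorA26` (OPEN; obligations (W), (M), (R) of the line remain),
on `MatrixDescartes` (stmt-ValiantsHypothesis-18050) or on `VP ≠ VNP`.
-/

-- `Summit.ValiantsHypothesis.ValiantsHypothesis.…` repeats a component by the D-0017 layout
-- (single-conjunct summit), which the `dupNamespace` linter flags; the name is mandated.
set_option linter.dupNamespace false

namespace Summit.ValiantsHypothesis.ValiantsHypothesis.Theorems.LacunarySymmetroidMatrixDescartes.WallBubbling.Bubbling

open Matrix Finset Filter Topology

/-! # Part 0 — definitions -/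

section Defs

variable {ι : Type*} [Fintype ι]

/-- The real exponential sum `t ↦ ∑ i, a i · exp (x i · t)`. [folklore] -/
noncomputable def expSum (a x : ι → ℝ) (t : ℝ) : ℝ := ∑ i, a i * Real.exp (x i * t)

/-- The merged coefficient of the exponent value `w`: `∑_{i : x i = w} a i`. [folklore] -/
noncomputable def classSum (a x : ι → ℝ) (w : ℝ) : ℝ := ∑ i, if x i = w then a i else 0

end Defs

section InertiaDefs

variable {n : Type*} [Fintype n]

/-- Symmetroid Gram shape: `M = v vᵀ − u uᵀ − w wᵀ` (signature `≤ (1,2)`, rank `≤ 3`). [folklore] -/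
def IsSymGram (M : Matrix n n ℝ) : Prop :=
  ∃ v u w : n → ℝ, M = vecMulVec v v - vecMulVec u u - vecMulVec w w

/-- `n₊(M) ≥ 2`, witness-style (two `M`-orthogonal vectors of positive `M`-norm). [folklore] -/
def TwoPos (M : Matrix n n ℝ) : Prop :=
  ∃ x y : n → ℝ, 0 < x ⬝ᵥ (M *ᵥ x) ∧ 0 < y ⬝ᵥ (M *ᵥ y) ∧ x ⬝ᵥ (M *ᵥ y) = 0

/-- `n₋(M) ≥ 3`, witness-style (three pairwise `M`-orthogonal vectors of negative `M`-norm). [folklore] -/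
def ThreeNeg (M : Matrix n n ℝ) : Prop :=
  ∃ x y z : n → ℝ, x ⬝ᵥ (M *ᵥ x) < 0 ∧ y ⬝ᵥ (M *ᵥ y) < 0 ∧ z ⬝ᵥ (M *ᵥ z) < 0 ∧
    x ⬝ᵥ (M *ᵥ y) = 0 ∧ x ⬝ᵥ (M *ᵥ z) = 0 ∧ y ⬝ᵥ (M *ᵥ z) = 0

end InertiaDefs

/-- Polarisation of the `2 × 2` determinant (verbatim from the line file). [this work] -/
noncomputable def polar (S T : Matrix (Fin 2) (Fin 2) ℝ) : ℝ := ((S + T).det - S.det - T.det) / 2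

/-- Realisable polar Gram matrices (verbatim from the line file). [this work] -/
def Realisable (G : Matrix (Fin 6) (Fin 6) ℝ) : Prop :=
  ∃ (ε : ℝ) (S : Fin 6 → Matrix (Fin 2) (Fin 2) ℝ), (ε = 1 ∨ ε = -1) ∧ (∀ l, (S l).IsSymm) ∧
    ∀ i j, G i j = ε * polar (S i) (S j)

/-- Block sums over pair-sum value classes vanish (verbatim from the line file). [this work] -/
def BlockSumsZero (δ : Fin 6 → ℝ) (G : Matrix (Fin 6) (Fin 6) ℝ) : Prop :=
  ∀ v : ℝ, (∑ k, ∑ l, if δ k + δ l = v then G k l else 0) = 0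

/-- The open twenty-locus (verbatim). [this work] -/
def TwentyLocus : Set (Fin 6 → ℝ) :=
  {δ | ∃ S : Fin 6 → Matrix (Fin 2) (Fin 2) ℝ, (∀ l, (S l).IsSymm) ∧
    20 ≤ {x : ℝ | 0 < x ∧ (∑ l, (x ^ (δ l)) • S l).det = 0}.ncard}

/-- The sorted simplex (verbatim). [this work] -/
def SortedSimplex : Set (Fin 6 → ℝ) := {δ | Monotone δ ∧ δ 0 = 0 ∧ δ (Fin.last 5) = 1}

/-- Obligation (B) of the line, verbatim. [this work] -/
def Stmt.stub_bubbling : Prop :=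
  ∀ δ ∈ SortedSimplex, δ ∈ closure TwentyLocus →
    (∃ i j k l : Fin 6, (i, j) ≠ (k, l) ∧ (i, j) ≠ (l, k) ∧ δ i + δ j = δ k + δ l) →
      ∃ G : Matrix (Fin 6) (Fin 6) ℝ, G ≠ 0 ∧ BlockSumsZero δ G ∧ Realisable G

/-- Members = ordered index pairs; the member `(k,l)` carries the exponent `δ k + δ l`. [this work] -/
abbrev Pair := Fin 6 × Fin 6

/-- The exponent of a member. [this work] -/
def pairExp (δ : Fin 6 → ℝ) : Pair → ℝ := fun p => δ p.1 + δ p.2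

/-- **Cluster-limit data at `δ⋆`** — what B4–B7 (+ B11) extract from a sequence `δ^ν → δ⋆` in the twenty-locus:
`C` zero clusters carrying `m c` zeros each (`∑ m c = 20`); per cluster the recentred, max-normalised coefficient
sequences `a c ν : Pair → ℝ` (moduli `≤ 1`) converging to `H c ≠ 0`, each `H c` realisable (closedness of the
realisable cone, B11); for every `ν` the `m c` zeros of the `ν`-th window function `expSum (a c ν) (pairExp (δseq ν))`
in `[−R c, R c]`; and for clusters `c < c′` the exact member-wise transfer `a c′ ν p = a c ν p · exp (xₚ L) · ρ`
with `L → +∞`, `ρ > 0` (same Gram matrix, two normalisations). [this work] -/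
structure ClusterLimit (δstar : Fin 6 → ℝ) where
  /-- number of clusters -/
  C : ℕ
  /-- zeros per cluster -/
  m : Fin C → ℕ
  hm : ∑ c, m c = 20
  /-- the exponent vectors along the extracted subsequence -/
  δseq : ℕ → Fin 6 → ℝ
  hδ : ∀ l, Tendsto (fun ν => δseq ν l) atTop (𝓝 (δstar l))
  /-- normalised recentred coefficients per cluster, and their limits -/
  a : Fin C → ℕ → Pair → ℝ
  H : Fin C → Pair → ℝ
  ha : ∀ c p, Tendsto (fun ν => a c ν p) atTop (𝓝 (H c p))
  hbound : ∀ c ν p, |a c ν p| ≤ 1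
  hH : ∀ c, H c ≠ 0
  hreal : ∀ c, Realisable (Matrix.of fun k l => H c (k, l))
  /-- window radii and the zeros -/
  R : Fin C → ℝ
  hzeros : ∀ c ν, ∃ Z : Finset ℝ, Z.card = m c ∧
    ∀ z ∈ Z, z ∈ Set.Icc (-(R c)) (R c) ∧ expSum (a c ν) (pairExp (δseq ν)) z = 0
  /-- inter-cluster distances and normalisation ratios -/
  L : Fin C → Fin C → ℕ → ℝ
  ρ : Fin C → Fin C → ℕ → ℝ
  hρ : ∀ c c' ν, 0 < ρ c c' ν
  hL : ∀ c c', c < c' → Tendsto (L c c') atTop atTop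
  htransfer : ∀ c c', c < c' → ∀ ν p, a c' ν p = a c ν p * Real.exp (pairExp (δseq ν) p * L c c' ν) * ρ c c' ν

end Summit.ValiantsHypothesis.ValiantsHypothesis.Theorems.LacunarySymmetroidMatrixDescartes.WallBubbling.Bubbling
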